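import Literature.MathematicalPhysics.QuantumFieldTheory.Balaban1983to89.B9B8CarrierDictionary
import Literature.MathematicalPhysics.QuantumFieldTheory.Balaban1983to89.B9B8AveragingKernelZd
import Literature.MathematicalPhysics.QuantumFieldTheory.Balaban1983to89.B9Thm311DeltaPrimeSymm

/-!
# `Balaban1983to89.B9B8AveragingJunction` — JUNCTION J-B, FILE 1: the [Balaban1985RegularSpaces] knit's averaging transporters
# `U(Γ^{(j)}_{y,x})` ([B9] (3.19) second form, `B9B8AveragingKernelZd.compT` of `B8Eq119TwistedAxial.bgT`) AS A def-Y SITE-TRANSPORTER LETTER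
# `parKnitY`, and the EXACT identity `Q′(U)` (def-Y, `Node00.OpsYDeltaA.QpY` at `parKnitY`) = `Q′_j(U₀)` (knit, `QprimeIter (zdBlocking) (bgT U₀) j`)

statement-level skeleton of published theorems with citation tags; proofs where landed; nothing here is a claim about the
Yang–Mills mass gap

T. Bałaban, *Propagators for lattice gauge theories in a background field*, Commun. Math. Phys. **99** (1985) 389–434
[`Balaban1985BackgroundPropagators`, "[B9]"]; T. Bałaban, *Spaces of regular gauge field configurations on a lattice and gauge fixing conditions*,
Commun. Math. Phys. **99** (1985) 75–102 [`Balaban1985RegularSpaces`, "[B8]"]; T. Bałaban, *Averaging operations for lattice gauge theories*,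
Commun. Math. Phys. **98** (1985) 17–51 [`Balaban1985Averaging`, "[B7]"].  PDFs held (`paper:balaban1985-cmp99-background-propagators`, journal
page = PDF page + 388).

THE PRINT (verbatim, [B9] p. 393).  *«Let us define Q′_j(U) = Q′(Ū^{j−1})·…·Q′(Ū)Q′(U), where (Q′(V)λ)(y) = Σ_{x∈B(y)} L^{−d}R(V(Γ_{y,x}))λ(x),
(Q′_j(U)λ)(y) = Σ_{x∈Bʲ(y)} L^{−jd}R(U(Γ^{(j)}_{y,x}))λ(x), y ∈ T^{(j)}_{Lʲη}. (3.19)  The contours Γ^{(j)}_{y,x}, x ∈ Bʲ(y), and the contour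
variables U(Γ^{(j)}_{y,x}) were defined by (52), (53) in [5].»*  ([5] = [B7]; r06's page check 2026-08-28T01:36Z: the one-block contour
`Γ_{y,x}` is the ordered axial contour of [B7] (1.7) = `B7Prop1Explicit.treeWord`, from the block's reference point.)

CITATION HEADER (lean-in-tree rule).  Cell `lit-balaban`, sub-row G-B9-LETTERS, JUNCTION MODULE **J-B** of the lead's RULING #3 (2026-08-28T01:14Z)
→ seat `lit-balaban-p33` gen 91; option (a) of `lit-balaban-p33/JAB-STATEMENTS.md` (F4)∕(F5): def-Y's operator layer is PARAMETRIC in the site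
transporter `parS : SiteParY 𝔸 i` (`Node00.OpsYDeltaA.QpY i parS`, `Node00.OpsYDeltaPrimeA.deltaPrimeAY i parS`), and the knit's `Q′_j(U₀)`
(`B7Eq78Linearization.QprimeIter (zdBlocking d L) (B8Eq119TwistedAxial.bgT L U₀) j`, pinned by (E5) `qp_reads` of
`B8Thm2TorusLetters.LettersAt`) is ONE kernel on the `Lʲ`-block with the composite transporter (`B9B8AveragingKernelZd.QprimeIter_zd_eq_sum_blockIter`);
so the knit's transporters, moved to def-Y's box chart (`B9B8CarrierDictionary.liftCfg ∕ liftFun`, `B6GlobalChartV1.boxEquiv`), ARE a `parS`.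
REUSED BY NAME, not restated: `blkOf ∕ bset ∕ corner ∕ coord_bounds` (`B6Geom246MultiLevelBox`), `cornerY ∕ levY ∕ avgTrY` (`Node00.OpsYDeltaPrimeA`),
`qpK ∕ qpT ∕ QpY ∕ blkCornerY ∕ trLiftY_apply` (`Node00.OpsYDeltaA`), `cornerY_levY_eq` (w1's `B9Thm311DeltaPrimeSymm`), `blockMap ∕ blockBase ∕ blockSites` (`QuantumLattice.BalabanRG`), `blockIter ∕
compT` (`B9B8AveragingKernelZd`), `bgT` (`B8Eq119TwistedAxial`), `axialFn_self` (`B8Eq115GaugeFixing`).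

WHAT THIS FILE PROVES (sorry-free; the definitions `knitT ∕ parOfT ∕ parKnitY` have bodies; everything else theorems).
* §1 THE BLOCK DICTIONARY (any member `i : KIdx`): p21's block label `blk b` IS the knit's `blockMap b` and p21's block corner IS `blockBase`
  (both `rfl`); `blockMap L` iterated `j` times is `blockMap (Lʲ)`; the knit's iterated block `blockIter L j y` IS `blockSites (Lʲ) y`; ★ a block of
  `𝔅` is FULL — every `x ∈ ℤ^{d+1}` with label `blk (Lʲ) x = y`, `(j, y) ∈ 𝔅`, lies in the fundamental box (`Lʲ ∣ N₀`); the chart of a box point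
  read on `ℤ^{d+1}` is itself (`boxEquiv_transl_of_mem`); hence ★ `Σ_{z ∈ 𝔅-block s} F(z) = Σ_{x ∈ blockSites (L^{j_s}) y_s} F(x)` (`sum_blkOf_eq_sum_blockSites`).
* §2 THE TRANSPORTER LETTER: for a level-transporter family `T` on `ℤ^{d+1}` (the knit's `bgT L U₀`), `knitT i T w := compT L T j(w) y(w) w` — print's
  `U(Γ^{(j)}_{y,x})` from the block's corner to `w` — and the def-Y site transporter `parOfT i T z w` (`= knitT w` if `z` is the corner of `w`'s block,
  `= (knitT z)⁻¹` if `w` is the corner of `z`'s block, `1` otherwise); `parKnitY i U := parOfT i (bgT L (liftCfg U))`.  Laws: the composite transporter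
  from a corner to itself is `1` (`compT_blockBase`), `parOfT` is INVERSE-SYMMETRIC (`parOfT_inv`, the `hinv` premise of w1's ∕ def-Y's symmetry and
  positivity theorems), the two corner legs (`parOfT_corner_left ∕ _right`), `parKnitY 1 = 1`.
* §3 ★★★ THE EXACT AVERAGING JUNCTION: for every member, background `U`, site function `Φ` and block `s = (j, y) ∈ 𝔅`,
  `QpY i (parKnitY i) U Φ s = QprimeIter (zdBlocking (d+1) L) (bgT L (liftCfg U)) j (liftFun (Φ ∘ boxEquiv)) y` (`QpY_parKnitY_eq_QprimeIter`) —
  def-Y's covariant block average at the knit transporter IS the knit's `j`-fold covariant average of the periodic lift, read at the block's label.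

HONEST SCOPE.  (i) This file identifies the AVERAGING OPERATORS `Q′`; the averaging TERM `Q′ᵀ a Q′` of `Δ′_a` (def-Y's `avgTrY ∕ avgCoeffY` vs the
knit's `QT L n (torusLam n) U₀ ∘ Aw ∘ Qp`) and the full `Δ′_a` junction on CONSTANT-LEVEL members (the trivial domain sequence `Ω₁ = … = Ω_n = T_η`
of sub-row G-B9-LETTERS; the knit's truncation-`n` letters use ONE level) are J-B file 2; symmetry ∕ positivity ∕ coercivity of `Δ′_a` at `parKnitY`
(w1's `B9Thm31SiteCoerciveReg335Y` is proved at def-Y's taxicab transporter `parSymY`, a DIFFERENT letter at `U ≠ 1`) are J-B file 3.  (ii) The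
member's carrier constraints are inherited (`KIdx`: `L = ℓ + 1` odd `≥ 5`, `k ≥ 2`, box side `N₀ = L^k·L·M_h·P′ = 2L^{m+K}`); the existence of
constant-level members for a given torus is J-A file 2.  (iii) Bookkeeping — no estimate of [B7]∕[B8]∕[B9] is proved or asserted here;
count-neutral (no new named fact); nothing continuum, nothing about OS axioms or the mass gap.  No `sorry`, no `axiom`, no `instance`, no
`notation`.  Seat `lit-balaban-p33` gen 91, 2026-08-28.
-/

noncomputable section

namespace Literature.MathematicalPhysics.QuantumFieldTheory.Balaban1983to89.B9B8AveragingJunction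

open B7Prop1Explicit renaming Site → LSite
open Literature.MathematicalPhysics.QuantumLattice (blockSites blockBase blockMap mem_blockSites_iff blockMap_blockBase_add_of_lt)
open B7Eq78Linearization (conjR QprimeIter zdBlocking)
open B8Eq119TwistedAxial (bgT bgT_one)
open B8Eq115GaugeFixing (axialFn_self)
open B10Eq27TorusAxialLog (transl transl_apply)
open B9Eq39Adjoint (R)
open B4Reflection242 (boxDom mem_boxDom blk blk_mul)
open B6MultiLevelBoxOperator (N0)
open B6Geom246MultiLevelBox (bset blkOf blkOf_val blkOf_eq_iff_blk exists_blkOf_eq scale_bounds lev_eq_of_blkOf_eq corner corner_mem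
  coord_bounds blkOf_corner lev_corner)
open B6GlobalChartV1 (PV boxEquiv boxEquiv_apply toBox toBox_apply)
open B6KLevelCensusIndexV1 (KIdx)
open B6Prop22KLevelTorusCensus (KTIdx)
open B9B8CarrierDictionary (liftFun liftFun_apply liftCfg)
open B9Thm311DeltaPrimeSymm (cornerY_levY_eq)
open B9B8AveragingKernelZd (blockIter mem_blockIter_iff compT compT_zero compT_succ compT_one_legs QprimeIter_zd_eq_sum_blockIter)
open Node00

variable {d ℓ : ℕ} {hd : 1 ≤ d + 1} {hL : Odd (ℓ + 1) ∧ 1 < ℓ + 1} {b₀ b₁ : ℝ}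
variable {𝔸 : Type} [NormedRing 𝔸] [NormedAlgebra ℂ 𝔸] [CompleteSpace 𝔸]

/-! ## §1 The block dictionary: p21's `blk ∕ corner ∕ 𝔅` (def-Y's carrier) ↔ the knit's `blockMap ∕ blockBase ∕ blockSites ∕ blockIter` -/

section Blocks

/-- p21's block label `blk b x = ⌊x/b⌋` IS the knit's `blockMap b x` (one definition written twice). [cite: Balaban1984PropagatorsII, (2.1) p.224; Balaban1985Averaging, (78) p.30, dictionary] -/
theorem blk_eq_blockMap (b : ℕ) (x : Fin (d + 1) → ℤ) : blk b x = blockMap b x := rfl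

/-- `j` block maps of side `L` compose to the block map of side `Lʲ` (`⌊⌊x/L⌋/L⌋ = ⌊x/L²⌋`, …). [cite: Balaban1985Averaging, (43) p.24 («k-th order averaging»), dictionary] -/
theorem blockMap_iterate (L j : ℕ) (x : Fin (d + 1) → ℤ) : (blockMap L)^[j] x = blockMap (L ^ j) x := by
  induction j generalizing x with
  | zero => funext μ; simp [blockMap]
  | succ j ih =>
      rw [Function.iterate_succ, Function.comp_apply, ih, B7BlockGeometry.blockMap_blockMap, pow_succ']

/-- the knit's iterated block `Bʲ(y)` IS the `Lʲ`-block `{Lʲy + t : 0 ≤ t < Lʲ}`. [cite: Balaban1985BackgroundPropagators, (3.19) p.393 («x ∈ Bʲ(y)»)] -/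
theorem blockIter_eq_blockSites (L : ℕ) [NeZero L] (j : ℕ) (y : Fin (d + 1) → ℤ) : blockIter L j y = blockSites (L ^ j) y := by
  ext x
  rw [mem_blockIter_iff, mem_blockSites_iff, blockMap_iterate]

/-- p21's block corner `L^j·y` IS the knit's `blockBase (Lʲ) y`. [cite: Balaban1984PropagatorsII, (2.1) p.224; Balaban1985Averaging, (78) p.30, dictionary] -/
theorem corner_eq_blockBase {Mh k R : ℕ} {P : Fin (d + 1) → ℕ} (D : B6MultiLevelBoxOperator.Domains d ℓ Mh k P R) (s : ↥(bset D)) :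
    corner D s = blockBase ((ℓ + 1) ^ s.1.1) s.1.2 := rfl

variable (i : KIdx d ℓ hd hL b₀ b₁)

/-- the coordinates of a point with a given `Lʲ`-label: `Lʲy_μ ≤ x_μ < Lʲy_μ + Lʲ`. [cite: Balaban1984PropagatorsII, (2.1) p.224, dictionary] -/
theorem coord_bounds_of_blk_eq {b : ℕ} (hb : 1 ≤ b) {x y : Fin (d + 1) → ℤ} (h : blk b x = y) (μ : Fin (d + 1)) :
    (b : ℤ) * y μ ≤ x μ ∧ x μ < (b : ℤ) * y μ + b := by
  have hbz : (0 : ℤ) < b := by exact_mod_cast hb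
  have hμ : x μ / (b : ℤ) = y μ := by rw [← h]; rfl
  have h1 : (b : ℤ) * (x μ / (b : ℤ)) + x μ % (b : ℤ) = x μ := Int.mul_ediv_add_emod _ _
  have h2 := Int.emod_nonneg (x μ) hbz.ne'
  have h3 := Int.emod_lt_of_pos (x μ) hbz
  rw [hμ] at h1
  constructor <;> linarith

/-- ★ **A BLOCK OF `𝔅` IS FULL**: every point of `ℤ^{d+1}` whose `L^{j_s}`-label is the label of the block `s ∈ 𝔅` lies in the fundamental box
(`L^{j_s}` divides the side `N₀ = L^k·L·M_h·P′`, `j_s ≤ k`, and the block meets the box). [cite: Balaban1984PropagatorsII, (2.1) p.224 («Ω_j is a union of blocks»), dictionary] -/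
theorem mem_XB_of_blk_eq (s : BlkY i) {x : Fin (d + 1) → ℤ} (hx : blk ((ℓ + 1) ^ s.1.1) x = s.1.2) : x ∈ (toKT i).XB := by
  obtain ⟨z₀, hz₀⟩ := exists_blkOf_eq i.D.toDomains s
  have hjk : s.1.1 ≤ i.k := (scale_bounds i.D.toDomains s).2
  have hb1 : 1 ≤ (ℓ + 1) ^ s.1.1 := Nat.one_le_pow _ _ (Nat.succ_pos ℓ)
  have hbz : (0 : ℤ) < (((ℓ + 1) ^ s.1.1 : ℕ) : ℤ) := by positivity
  have hcor := mem_boxDom.1 (corner_mem i.D.toDomains s)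
  have hz₀box := mem_boxDom.1 z₀.2
  rw [KTIdx.XB, mem_boxDom]
  intro μ
  obtain ⟨hlo, hhi⟩ := coord_bounds_of_blk_eq hb1 hx μ
  obtain ⟨hlo₀, -⟩ := coord_bounds i.D.toDomains hz₀ μ
  have hc0 : 0 ≤ (((ℓ + 1) ^ s.1.1 : ℕ) : ℤ) * s.1.2 μ := (hcor μ).1
  refine ⟨le_trans hc0 hlo, ?_⟩
  -- `N₀_μ = L^{j} · q`
  obtain ⟨q, hq⟩ : ∃ q : ℕ, N0 ℓ i.Mh i.k i.P' μ = (ℓ + 1) ^ s.1.1 * q :=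
    ⟨(ℓ + 1) ^ (i.k - s.1.1) * ((ℓ + 1) * (i.Mh * i.P' μ)), by
      rw [← mul_assoc, ← pow_add, Nat.add_sub_cancel' hjk]⟩
  have hN : ((N0 ℓ i.Mh i.k i.P' μ : ℕ) : ℤ) = (((ℓ + 1) ^ s.1.1 : ℕ) : ℤ) * q := by rw [hq]; push_cast; ring
  have hz₀lt : z₀.1 μ < (((ℓ + 1) ^ s.1.1 : ℕ) : ℤ) * q := hN ▸ (hz₀box μ).2
  have hyq : s.1.2 μ < q := by
    by_contra hcon
    push Not at hcon
    have : (((ℓ + 1) ^ s.1.1 : ℕ) : ℤ) * q ≤ (((ℓ + 1) ^ s.1.1 : ℕ) : ℤ) * s.1.2 μ := mul_le_mul_of_nonneg_left hcon hbz.le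
    linarith
  show x μ < ((N0 ℓ i.Mh i.k i.P' μ : ℕ) : ℤ)
  rw [hN]
  have : (((ℓ + 1) ^ s.1.1 : ℕ) : ℤ) * (s.1.2 μ + 1) ≤ (((ℓ + 1) ^ s.1.1 : ℕ) : ℤ) * q :=
    mul_le_mul_of_nonneg_left (by linarith) hbz.le
  linarith

/-- the box site of a point of a full block. [cite: Balaban1984PropagatorsII, (2.1) p.224, dictionary] -/
def siteOfBlk (s : BlkY i) (x : Fin (d + 1) → ℤ) (hx : blk ((ℓ + 1) ^ s.1.1) x = s.1.2) : SiteY i := ⟨x, mem_XB_of_blk_eq i s hx⟩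

/-- … lies in the block. [cite: Balaban1984PropagatorsII, (2.1) p.224, dictionary] -/
theorem blkOf_siteOfBlk (s : BlkY i) (x : Fin (d + 1) → ℤ) (hx : blk ((ℓ + 1) ^ s.1.1) x = s.1.2) :
    blkOf i.D.toDomains (siteOfBlk i s x hx) = s :=
  (blkOf_eq_iff_blk i.D.toDomains).2 hx

/-- ★ THE CHART OF A BOX POINT READ ON `ℤ^{d+1}` IS ITSELF: `boxEquiv (0 + x) = x` for `x` in the fundamental box (the knit reads the torus
`P`-periodically on `ℤ^{d+1}`, def-Y through the box chart; on the box the two readings coincide). [cite: Balaban1985RegularSpaces, p.77 («Ω_j = T_η»); Balaban1984PropagatorsII, (2.1) p.224, dictionary] -/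
theorem boxEquiv_transl_of_mem {x : Fin (d + 1) → ℤ} (hx : x ∈ (toKT i).XB) :
    boxEquiv i.hN (transl (0 : Site (PV d ℓ i.m i.K hd hL) 0) x) = ⟨x, hx⟩ := by
  apply Subtype.ext
  funext μ
  have hμ := (mem_boxDom.1 hx) μ
  have hNpos : 0 < (PV d ℓ i.m i.K hd hL).sitesPerDir 0 := by
    rw [← i.hN μ]; exact lt_of_le_of_lt (Nat.zero_le _) (by exact_mod_cast lt_of_le_of_lt hμ.1 hμ.2)
  haveI : NeZero ((PV d ℓ i.m i.K hd hL).sitesPerDir 0) := ⟨hNpos.ne'⟩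
  have hval : transl (0 : Site (PV d ℓ i.m i.K hd hL) 0) x μ = ((x μ : ℤ) : ZMod ((PV d ℓ i.m i.K hd hL).sitesPerDir 0)) := by
    rw [transl_apply]; exact zero_add _
  rw [boxEquiv_apply, toBox_apply, hval, ZMod.val_intCast]
  have hlt : x μ < (((PV d ℓ i.m i.K hd hL).sitesPerDir 0 : ℕ) : ℤ) := by rw [← i.hN μ]; exact hμ.2
  exact Int.emod_eq_of_lt hμ.1 hlt

omit [NormedRing 𝔸] [NormedAlgebra ℂ 𝔸] [CompleteSpace 𝔸] in
/-- the periodic lift of a box-chart function, read at a box point, is the function there. [cite: Balaban1985RegularSpaces, p.77 («Ω_j = T_η»), dictionary] -/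
theorem liftFun_chart_apply (Φ : SiteY i → 𝔸) (z : SiteY i) :
    liftFun (Φ ∘ ⇑(boxEquiv i.hN)) z.1 = Φ z := by
  rw [liftFun_apply, Function.comp_apply, boxEquiv_transl_of_mem i z.2]
  rfl

/-- ★ **A SUM OVER A BLOCK OF `𝔅` IS A SUM OVER THE KNIT's BLOCK**: `Σ_{z ∈ s} F(z) = Σ_{x ∈ blockSites (L^{j_s}) y_s} F(x)` for any `F` on
`ℤ^{d+1}`. [cite: Balaban1985BackgroundPropagators, (3.19) p.393 («x ∈ Bʲ(y)»); Balaban1984PropagatorsII, (2.14) p.225, dictionary] -/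
theorem sum_blkOf_eq_sum_blockSites {M : Type*} [AddCommMonoid M] (s : BlkY i) (F : (Fin (d + 1) → ℤ) → M) :
    ∑ z ∈ Finset.univ.filter (fun z : SiteY i => blkOf i.D.toDomains z = s), F z.1
      = ∑ x ∈ blockSites ((ℓ + 1) ^ s.1.1) s.1.2, F x := by
  refine Finset.sum_bij (fun z _ => z.1) (fun z hz => ?_) (fun z₁ _ z₂ _ h => Subtype.ext h) (fun x hx => ?_) (fun z _ => rfl)
  · rw [mem_blockSites_iff, ← blk_eq_blockMap]
    exact (blkOf_eq_iff_blk i.D.toDomains).1 (Finset.mem_filter.1 hz).2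
  · rw [mem_blockSites_iff, ← blk_eq_blockMap] at hx
    exact ⟨siteOfBlk i s x hx, Finset.mem_filter.2 ⟨Finset.mem_univ _, blkOf_siteOfBlk i s x hx⟩, rfl⟩

end Blocks

/-! ## §2 The knit's transporters as a def-Y site-transporter letter -/

section Transporter

variable (i : KIdx d ℓ hd hL b₀ b₁)

/-- block bases compose: `L^j·(L·y) = L^{j+1}·y`. [cite: Balaban1985Averaging, (43) p.24, bookkeeping] -/
theorem blockBase_blockBase (M M' : ℕ) (y : Fin (d + 1) → ℤ) : blockBase M (blockBase M' y) = blockBase (M * M') y := by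
  funext μ; simp [blockBase, mul_assoc]

omit [NormedAlgebra ℂ 𝔸] [CompleteSpace 𝔸] in
/-- the composite transporter from a CORNER TO ITSELF is `1`, for legs trivial at the block base (`T_j(y, L·y) = 1`, as for the knit's
`bgT`: the axial contour from `L·y` to `L·y` is empty). [cite: Balaban1985BackgroundPropagators, (3.19) p.393; Balaban1985Averaging, (52)–(53) p.27, bookkeeping] -/
theorem compT_blockBase {L : ℕ} (hL1 : 1 ≤ L) (T : ℕ → (Fin (d + 1) → ℤ) → (Fin (d + 1) → ℤ) → 𝔸ˣ)
    (hT : ∀ j y, T j y (blockBase L y) = 1) : ∀ (j : ℕ) (y : Fin (d + 1) → ℤ), compT L T j y (blockBase (L ^ j) y) = 1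
  | 0, y => compT_zero L T _ _
  | j + 1, y => by
      have hLpos : 0 < L := hL1
      have hanc : (blockMap L)^[j] (blockBase (L ^ (j + 1)) y) = blockBase L y := by
        rw [blockMap_iterate, pow_succ, ← blockBase_blockBase]
        have h := blockMap_blockBase_add_of_lt (L ^ j) (blockBase L y) 0 (fun _ => le_rfl)
          (fun _ => by rw [Pi.zero_apply]; exact_mod_cast pow_pos hLpos j)
        rwa [add_zero] at h
      rw [compT_succ, hanc, hT, one_mul, pow_succ, ← blockBase_blockBase]
      exact compT_blockBase hL1 T hT j (blockBase L y)

/-- the knit's level legs are trivial at the block base: `bgT L U₀ j y (L·y) = 1`. [cite: Balaban1985RegularSpaces, (1.29) p.81; Balaban1985Averaging, (78) p.30, bookkeeping] -/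
theorem bgT_blockBase (L : ℕ) (U₀ : LSite (d + 1) → Fin (d + 1) → 𝔸ˣ) (j : ℕ) (y : Fin (d + 1) → ℤ) :
    bgT L U₀ j y (blockBase L y) = 1 :=
  axialFn_self _ _

/-- **`U(Γ^{(j)}_{y,w})`, THE KNIT's COMPOSITE TRANSPORTER TO A BOX SITE `w` from the corner of ITS block of `𝔅`** (`j = j(w)` the site's level,
`y` its `Lʲ`-label), for a level-transporter family `T` on `ℤ^{d+1}`. [cite: Balaban1985BackgroundPropagators, (3.19) p.393; Balaban1985Averaging, (52)–(53) p.27] -/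
def knitT (T : ℕ → (Fin (d + 1) → ℤ) → (Fin (d + 1) → ℤ) → 𝔸ˣ) (w : SiteY i) : 𝔸ˣ :=
  compT (ℓ + 1) T (levY i w) (blk ((ℓ + 1) ^ levY i w) w.1) w.1

open Classical in
/-- **THE def-Y SITE TRANSPORTER OF THE KNIT's AVERAGING**: `U(Γ_{z,w}) := U(Γ^{(j)}_{y,w})` when `z` is the corner of `w`'s block, the inverse
`U(Γ^{(j)}_{y,z})⁻¹` when `w` is the corner of `z`'s block (the leg of `Q′*`, transporting back to the site), `1` otherwise (pairs the averaging
letters never read). [cite: Balaban1985BackgroundPropagators, (3.19) p.393, (3.24)–(3.25) pp.394–395] -/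
def parOfT (T : ℕ → (Fin (d + 1) → ℤ) → (Fin (d + 1) → ℤ) → 𝔸ˣ) (z w : SiteY i) : 𝔸ˣ :=
  if cornerY i (levY i w) w = z then knitT i T w else if cornerY i (levY i z) z = w then (knitT i T z)⁻¹ else 1

/-- ★ **`parKnitY`: THE KNIT's TRANSPORTERS AS A def-Y LETTER** — `parOfT` at the knit's level transporters `bgT L U₀` of the periodic lift
`U₀ = liftCfg U` of the member's background. [cite: Balaban1985BackgroundPropagators, (3.19) p.393; Balaban1985RegularSpaces, (1.29) p.81] -/
def parKnitY : SiteParY 𝔸 i := fun U => parOfT i (bgT (ℓ + 1) (liftCfg U))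

/-- the corner of the block `s` has level `j_s`. [cite: Balaban1984PropagatorsII, (2.3)–(2.4) p.224, bookkeeping] -/
theorem levY_blkCornerY (s : BlkY i) : levY i (blkCornerY i s) = s.1.1 := lev_corner i.D.toDomains s

/-- the label of a block's corner is the block's label. [cite: Balaban1984PropagatorsII, (2.1) p.224, bookkeeping] -/
theorem blk_blkCornerY (s : BlkY i) : blk ((ℓ + 1) ^ s.1.1) (blkCornerY i s).1 = s.1.2 :=
  blk_mul (Nat.one_le_pow _ _ (Nat.succ_pos ℓ)) s.1.2

/-- the corner of a corner's block is the corner. [cite: Balaban1985BackgroundPropagators, (3.19) p.393, bookkeeping] -/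
theorem cornerY_blkCornerY (s : BlkY i) : cornerY i s.1.1 (blkCornerY i s) = blkCornerY i s := by
  apply Subtype.ext; funext μ
  rw [cornerY_apply, blk_blkCornerY]
  rfl

/-- a site of the block `s` has level `j_s`. [cite: Balaban1984PropagatorsII, (2.3)–(2.4) p.224, bookkeeping] -/
theorem levY_of_blkOf {z : SiteY i} {s : BlkY i} (h : blkOf i.D.toDomains z = s) : levY i z = s.1.1 := lev_eq_of_blkOf_eq i.D.toDomains h

omit [NormedAlgebra ℂ 𝔸] [CompleteSpace 𝔸] in
/-- ★ THE TRANSPORTER FROM THE CORNER OF A BLOCK TO ITS SITE is the knit's composite transporter `T^{(j_s)}(y_s, z)`.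
[cite: Balaban1985BackgroundPropagators, (3.19) p.393] -/
theorem knitT_of_blkOf (T : ℕ → (Fin (d + 1) → ℤ) → (Fin (d + 1) → ℤ) → 𝔸ˣ) {z : SiteY i} {s : BlkY i} (h : blkOf i.D.toDomains z = s) :
    knitT i T z = compT (ℓ + 1) T s.1.1 s.1.2 z.1 := by
  rw [knitT, levY_of_blkOf i h, (blkOf_eq_iff_blk i.D.toDomains).1 h]

omit [NormedAlgebra ℂ 𝔸] [CompleteSpace 𝔸] in
/-- the composite transporter to a CORNER is `1` (legs trivial at block bases). [cite: Balaban1985BackgroundPropagators, (3.19) p.393, bookkeeping] -/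
theorem knitT_blkCornerY (T : ℕ → (Fin (d + 1) → ℤ) → (Fin (d + 1) → ℤ) → 𝔸ˣ) (hT : ∀ j y, T j y (blockBase (ℓ + 1) y) = 1) (s : BlkY i) :
    knitT i T (blkCornerY i s) = 1 := by
  have h : blkOf i.D.toDomains (blkCornerY i s) = s := blkOf_corner i.D.toDomains s
  rw [knitT_of_blkOf i T h]
  exact compT_blockBase (Nat.succ_pos ℓ) T hT s.1.1 s.1.2

omit [NormedAlgebra ℂ 𝔸] [CompleteSpace 𝔸] in
/-- the same at `cornerY (j(z)) z`. [cite: Balaban1985BackgroundPropagators, (3.19) p.393, bookkeeping] -/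
theorem knitT_cornerY (T : ℕ → (Fin (d + 1) → ℤ) → (Fin (d + 1) → ℤ) → 𝔸ˣ) (hT : ∀ j y, T j y (blockBase (ℓ + 1) y) = 1) (z : SiteY i) :
    knitT i T (cornerY i (levY i z) z) = 1 := by
  rw [cornerY_levY_eq]; exact knitT_blkCornerY i T hT _

omit [NormedAlgebra ℂ 𝔸] [CompleteSpace 𝔸] in
/-- ★ THE FORWARD LEG: from the corner of `w`'s block to `w`, `parOfT` is the composite transporter. [cite: Balaban1985BackgroundPropagators, (3.19) p.393] -/
theorem parOfT_corner_left (T : ℕ → (Fin (d + 1) → ℤ) → (Fin (d + 1) → ℤ) → 𝔸ˣ) (w : SiteY i) :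
    parOfT i T (cornerY i (levY i w) w) w = knitT i T w := by
  unfold parOfT; rw [if_pos rfl]

omit [NormedAlgebra ℂ 𝔸] [CompleteSpace 𝔸] in
/-- the forward leg, block form: `parOfT (corner of s) z = T^{(j_s)}(y_s, z)` for `z ∈ s`. [cite: Balaban1985BackgroundPropagators, (3.19) p.393] -/
theorem parOfT_blkCornerY (T : ℕ → (Fin (d + 1) → ℤ) → (Fin (d + 1) → ℤ) → 𝔸ˣ) {z : SiteY i} {s : BlkY i} (h : blkOf i.D.toDomains z = s) :
    parOfT i T (blkCornerY i s) z = compT (ℓ + 1) T s.1.1 s.1.2 z.1 := by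
  have hc : cornerY i (levY i z) z = blkCornerY i s := by rw [cornerY_levY_eq, h]
  rw [← hc, parOfT_corner_left, knitT_of_blkOf i T h]

omit [NormedAlgebra ℂ 𝔸] [CompleteSpace 𝔸] in
/-- ★ THE BACKWARD LEG: from `z` to the corner of its block, `parOfT` is the INVERSE composite transporter (legs trivial at block bases).
[cite: Balaban1985BackgroundPropagators, (3.24)–(3.25) pp.394–395 («Q′*»)] -/
theorem parOfT_corner_right (T : ℕ → (Fin (d + 1) → ℤ) → (Fin (d + 1) → ℤ) → 𝔸ˣ) (hT : ∀ j y, T j y (blockBase (ℓ + 1) y) = 1) (z : SiteY i) :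
    parOfT i T z (cornerY i (levY i z) z) = (knitT i T z)⁻¹ := by
  unfold parOfT
  have hcc : cornerY i (levY i (cornerY i (levY i z) z)) (cornerY i (levY i z) z) = cornerY i (levY i z) z := by
    rw [cornerY_levY_eq i z, levY_blkCornerY, cornerY_blkCornerY]
  by_cases hz : cornerY i (levY i z) z = z
  · -- `z` is a corner: both legs are `1`
    rw [hcc, if_pos hz]
    have h1 : knitT i T z = 1 := by rw [← hz]; exact knitT_cornerY i T hT z
    rw [hz, h1, inv_one]
  · rw [hcc, if_neg hz, if_pos rfl]

omit [NormedAlgebra ℂ 𝔸] [CompleteSpace 𝔸] in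
/-- ★ **`parOfT` IS INVERSE-SYMMETRIC**: `U(Γ_{z,w}) = U(Γ_{w,z})⁻¹` — the `hinv` premise of def-Y's ∕ w1's symmetry, positivity and coercivity
theorems for `Δ′_a(U)` at a transporter letter. [cite: Balaban1985BackgroundPropagators, (3.25) p.395 («Δ′_a is positive»), (3.19) p.393] -/
theorem parOfT_inv (T : ℕ → (Fin (d + 1) → ℤ) → (Fin (d + 1) → ℤ) → 𝔸ˣ) (hT : ∀ j y, T j y (blockBase (ℓ + 1) y) = 1) (z w : SiteY i) :
    parOfT i T z w = (parOfT i T w z)⁻¹ := by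
  by_cases h1 : cornerY i (levY i w) w = z
  · rw [← h1, parOfT_corner_left, parOfT_corner_right i T hT, inv_inv]
  · by_cases h2 : cornerY i (levY i z) z = w
    · rw [← h2, parOfT_corner_right i T hT, parOfT_corner_left]
    · unfold parOfT
      rw [if_neg h1, if_neg h2, if_neg h2, if_neg h1, inv_one]

/-- ★ `parKnitY` is inverse-symmetric. [cite: Balaban1985BackgroundPropagators, (3.25) p.395, (3.19) p.393] -/
theorem parKnitY_inv (U : CfgY 𝔸 i) (z w : SiteY i) : parKnitY i U z w = (parKnitY i U w z)⁻¹ :=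
  parOfT_inv i _ (fun j y => bgT_blockBase (ℓ + 1) (liftCfg U) j y) z w

omit [NormedAlgebra ℂ 𝔸] [CompleteSpace 𝔸] in
/-- with trivial legs the letter is trivial. [cite: Balaban1985BackgroundPropagators, Cor. 3.5 p.407 (U = 1), bookkeeping] -/
theorem parOfT_one_legs (z w : SiteY i) : parOfT i (fun _ _ _ => (1 : 𝔸ˣ)) z w = 1 := by
  unfold parOfT knitT
  rw [compT_one_legs, compT_one_legs, inv_one]
  split_ifs <;> rfl

/-- ★ AT `U = 1` THE KNIT LETTER IS TRIVIAL (`parKnitY 1 = 1`, the `hpar` premise of def-Y's `U = 1` clauses `deltaPrimeAY_one`, `QpY`∕`QpsY` at one).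
[cite: Balaban1985BackgroundPropagators, p.395 («It coincides with Δ_a in (2.19) if U = 1»), Cor. 3.5 p.407] -/
theorem parKnitY_one (z w : SiteY i) : parKnitY i (fun _ _ => (1 : 𝔸ˣ)) z w = 1 := by
  have h1 : bgT (ℓ + 1) (liftCfg (P := PV d ℓ i.m i.K hd hL) fun _ _ => (1 : 𝔸ˣ)) = fun _ _ _ => 1 := bgT_one (ℓ + 1)
  show parOfT i (bgT (ℓ + 1) (liftCfg (P := PV d ℓ i.m i.K hd hL) fun _ _ => (1 : 𝔸ˣ))) z w = 1
  rw [h1]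
  exact parOfT_one_legs i z w

end Transporter

/-! ## §3 The exact averaging junction `Q′(U)`(def-Y at `parKnitY`) `=` `Q′_j(U₀)`(knit) -/

section Junction

variable (i : KIdx d ℓ hd hL b₀ b₁)

/-- the block weight of `𝔅` IS the knit's iterated weight: `W(s)⁻¹ = (L^{−(d+1)})^{j_s}`. [cite: Balaban1985BackgroundPropagators, (3.19) p.393 («L^{−jd}»); Balaban1984PropagatorsII, (2.69) p.235] -/
theorem inv_W_eq_pow (s : BlkY i) :
    (B6Ineq268MultiLevelBox.W i.D.toDomains s)⁻¹ = ((((ℓ + 1 : ℕ) : ℝ) ^ (d + 1))⁻¹) ^ s.1.1 := by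
  rw [B6Ineq268MultiLevelBox.W_eq, Nat.cast_add_one, inv_pow, ← pow_mul, ← pow_mul, mul_comm]

omit [CompleteSpace 𝔸] in
/-- ★★ **THE TRANSPORTED BLOCK-AVERAGE KERNEL AT `parOfT T` IS THE KNIT's `j`-FOLD AVERAGE WITH LEGS `T`**: for every block `s = (j, y) ∈ 𝔅` and
site function `Φ`, `Σ_z q′(s, z) R(parOfT T (corner s) z) Φ(z) = (Q′_j[T] liftFun(Φ ∘ chart))(y)`. [cite: Balaban1985BackgroundPropagators, (3.19) p.393, (3.21) p.394] -/
theorem trLiftY_qpK_parOfT_eq (T : ℕ → (Fin (d + 1) → ℤ) → (Fin (d + 1) → ℤ) → 𝔸ˣ) (Φ : SiteY i → 𝔸) (s : BlkY i) :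
    trLiftY (qpK i) (fun s' z => parOfT i T (blkCornerY i s') z) Φ s
      = QprimeIter (zdBlocking (d + 1) (ℓ + 1)) T s.1.1 (liftFun (Φ ∘ ⇑(boxEquiv i.hN))) s.1.2 := by
  have hq : ∀ z : SiteY i, qpK i s z = if blkOf i.D.toDomains z = s then (B6Ineq268MultiLevelBox.W i.D.toDomains s)⁻¹ else 0 :=
    fun _ => rfl
  rw [trLiftY_apply, QprimeIter_zd_eq_sum_blockIter, blockIter_eq_blockSites]
  -- restrict def-Y's sum to the block `s`
  have hL : ∑ z : SiteY i, ((qpK i s z : ℝ) : ℂ) • R (parOfT i T (blkCornerY i s) z) (Φ z)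
      = ∑ z ∈ Finset.univ.filter (fun z : SiteY i => blkOf i.D.toDomains z = s),
          (((((ℓ + 1 : ℕ) : ℝ) ^ (d + 1))⁻¹) ^ s.1.1 : ℝ) • conjR (compT (ℓ + 1) T s.1.1 s.1.2 z.1)
            (liftFun (Φ ∘ ⇑(boxEquiv i.hN)) z.1) := by
    rw [Finset.sum_filter]
    refine Finset.sum_congr rfl fun z _ => ?_
    split_ifs with h
    · rw [hq z, if_pos h, inv_W_eq_pow, parOfT_blkCornerY i T h, liftFun_chart_apply, Complex.coe_smul]
      rfl
    · rw [hq z, if_neg h, Complex.ofReal_zero, zero_smul]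
  rw [hL]
  exact sum_blkOf_eq_sum_blockSites i s fun x =>
    (((((ℓ + 1 : ℕ) : ℝ) ^ (d + 1))⁻¹) ^ s.1.1 : ℝ) • conjR (compT (ℓ + 1) T s.1.1 s.1.2 x) (liftFun (Φ ∘ ⇑(boxEquiv i.hN)) x)

/-- ★★★ **THE EXACT AVERAGING JUNCTION.**  For every member `i` of the k-level family, every background `U` on its torus, every site function `Φ`
and every block `s = (j, y) ∈ 𝔅`: def-Y's COVARIANT BLOCK AVERAGE `Q′(U)` (3.21) at the knit transporter letter `parKnitY`, evaluated at `s`, IS the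
[B8]-knit's `j`-FOLD COVARIANT AVERAGE `Q′_j(U₀) = Q′(Ū₀^{j−1})⋯Q′(U₀)` ((3.19) first form, `QprimeIter (zdBlocking (d+1) L) (bgT L U₀) j`, the letter
pinned by (E5) `qp_reads` of `B8Thm2TorusLetters.LettersAt`) of the periodic lift of `Φ`, at the background `U₀ = liftCfg U`, evaluated at the label `y`.
[cite: Balaban1985BackgroundPropagators, (3.19) p.393, (3.21) p.394; Balaban1985RegularSpaces, (1.29) p.81] -/
theorem QpY_parKnitY_eq_QprimeIter (U : CfgY 𝔸 i) (Φ : SiteY i → 𝔸) (s : BlkY i) :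
    QpY i (parKnitY i) U Φ s
      = QprimeIter (zdBlocking (d + 1) (ℓ + 1)) (bgT (ℓ + 1) (liftCfg U)) s.1.1 (liftFun (Φ ∘ ⇑(boxEquiv i.hN))) s.1.2 :=
  trLiftY_qpK_parOfT_eq i (bgT (ℓ + 1) (liftCfg U)) Φ s

/-- the same with def-Y's level-transporter family abstracted (any `T` with the knit's block geometry). [cite: Balaban1985BackgroundPropagators, (3.19) p.393, (3.21) p.394] -/
theorem QpY_parOfT_eq_QprimeIter (T : ℕ → (Fin (d + 1) → ℤ) → (Fin (d + 1) → ℤ) → 𝔸ˣ) (U : CfgY 𝔸 i) (Φ : SiteY i → 𝔸) (s : BlkY i) :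
    QpY i (fun _ => parOfT i T) U Φ s = QprimeIter (zdBlocking (d + 1) (ℓ + 1)) T s.1.1 (liftFun (Φ ∘ ⇑(boxEquiv i.hN))) s.1.2 :=
  trLiftY_qpK_parOfT_eq i T Φ s

/-- ★ COROLLARY (the block sum): `Σ_{z ∈ s} R(U(Γ^{(j)}_{y,z}))Φ(z) = W(s) · (Q′_j(U₀) liftFun Φ)(y)` — def-Y's transported block sum at `parKnitY` in the
knit's currency. [cite: Balaban1985BackgroundPropagators, (3.19) p.393; Balaban1984PropagatorsII, (2.16)–(2.17) p.225] -/
theorem sum_block_R_parKnitY_eq (U : CfgY 𝔸 i) (Φ : SiteY i → 𝔸) (s : BlkY i) :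
    ∑ z ∈ Finset.univ.filter (fun z : SiteY i => blkOf i.D.toDomains z = s), R (parKnitY i U (blkCornerY i s) z) (Φ z)
      = ((B6Ineq268MultiLevelBox.W i.D.toDomains s : ℝ) : ℂ) •
          QprimeIter (zdBlocking (d + 1) (ℓ + 1)) (bgT (ℓ + 1) (liftCfg U)) s.1.1 (liftFun (Φ ∘ ⇑(boxEquiv i.hN))) s.1.2 := by
  have hq : ∀ z : SiteY i, qpK i s z = if blkOf i.D.toDomains z = s then (B6Ineq268MultiLevelBox.W i.D.toDomains s)⁻¹ else 0 :=
    fun _ => rfl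
  have hW : (B6Ineq268MultiLevelBox.W i.D.toDomains s) ≠ 0 := (B6Ineq268MultiLevelBox.W_pos _ s).ne'
  rw [← QpY_parKnitY_eq_QprimeIter, QpY, trLiftY_apply, Finset.smul_sum, Finset.sum_filter]
  refine Finset.sum_congr rfl fun z _ => ?_
  rw [hq z]
  split_ifs with h
  · rw [smul_smul, ← Complex.ofReal_mul, mul_inv_cancel₀ hW, Complex.ofReal_one, one_smul]
    rfl
  · rw [Complex.ofReal_zero, zero_smul, smul_zero]

end Junction

end Literature.MathematicalPhysics.QuantumFieldTheory.Balaban1983to89.B9B8AveragingJunction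

end
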